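import Summits.AnomalousDissipation.AnomalousDissipation.Theorems.EnsembleCeiling.Negative.BeltramiFat
import Literature.Analysis.FunctionSpaces.TorusFluidGlueProofs
import HarnessLib

/-!
# `stub_f123NoOnsagerDodger` in the small-energy regime (helper for crux stmt-AnomalousDissipation-13038,
# line `lamb-floor-f123-shared-ceiling`)

The floor stub of the line asks that, at EVERY energy level `E`, bad sequences of the detuned cyclic force
`f₁₂₃ = (sin 2πx₃, sin 4πx₁, sin 6πx₂)` (admissible `u_n` with `∫|u_n|² ≤ E`, dual residual bounds `R_n → 0`
and vanishing virtual dissipation `R_n ‖∇u_n‖ → 0`) have non-divergent enstrophy. This file settles the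
VACUOUS REGIME, for every smooth divergence-free force `f` with a derivative bound `‖Df‖ ≤ M`:

* `integral_norm_sq_le_of_residualBound` — testing the residual bound with `w = f` and using the
  antisymmetry of the trilinear form, `∫‖f‖² ≤ R·√(gradNormSq f) + M ∫‖u‖²` for every admissible `u`;
* `noOnsagerDodger_of_smallEnergy` — hence if `M · E < ∫‖f‖²` there is NO bad sequence at level `E` at all
  (`R_n → 0` contradicts the previous inequality), so the stub's conclusion holds there;
* `stub_f123NoOnsagerDodgerSmallEnergy` (registered sub-stub) — the instance for `f₁₂₃`: some explicit-in-principle `E₀ > 0` below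
  which `stub_f123NoOnsagerDodger` holds. (The stub itself is the statement for ALL `E`; the interesting regime
  `E ≥ ∫‖f‖²/M` is open — see the line's notes on vortex-sheet dodgers.)
-/

noncomputable section

-- `Summit.<Summit>.<Problem>` is the tree's mandated summit-side namespace (CONVENTIONS §2); single-conjunct summit, duplicate deliberate.
set_option linter.dupNamespace false

open MeasureTheory Filter Topology UnitAddTorus Matrix
open scoped InnerProductSpace ENNReal ComplexConjugate

namespace Summit.AnomalousDissipation.AnomalousDissipation.Theorems.SteadyStatesLoudBounded.F123SmallEnergy

open Literature.Analysis.FunctionSpaces Literature.Analysis.FluidPDE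
open Summit.AnomalousDissipation.AnomalousDissipation.Theorems.TaylorCertificatePair.Negative
open Summit.AnomalousDissipation.AnomalousDissipation.Theorems.EnsembleCeiling.Negative

/-- The torus derivative of a smooth map is bounded (continuity on the compact torus). -/
theorem exists_bound_fderiv' {f : (UnitAddTorus (Fin 3) → EuclideanSpace ℝ (Fin 3))} (hf : Torus.IsSmooth f) :
    ∃ M : ℝ, 0 ≤ M ∧ ∀ x, ‖Torus.fderiv f x‖ ≤ M := by
  have hf1 : Torus.IsContDiff 1 f := hf.isContDiff (by simp)
  have hc : Continuous (Torus.fderiv f) := hf1.continuous_fderiv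
  obtain ⟨C, hC⟩ := isCompact_univ.exists_bound_of_continuousOn hc.continuousOn
  exact ⟨max C 0, le_max_right _ _, fun x => (hC x (Set.mem_univ x)).trans (le_max_left _ _)⟩

/-- **Testing the residual bound with the force itself.** For smooth `f` with `‖Df‖ ≤ M`, a smooth
divergence-free `u`, and a residual bound `|∫⟪(u·∇)u − f, f⟫| ≤ R √(gradNormSq f)`:
`∫‖f‖² ≤ R √(gradNormSq f) + M ∫‖u‖²` (antisymmetry `∫⟪(u·∇)u, f⟫ = −∫⟪u, (u·∇)f⟫` and `‖(u·∇)f‖ ≤ M‖u‖`). -/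
theorem integral_norm_sq_le_of_residualBound {f u : (UnitAddTorus (Fin 3) → EuclideanSpace ℝ (Fin 3))} (hf : Torus.IsSmooth f) (hu : Torus.IsSmooth u)
    (hud : Torus.IsDivFree u) {M R : ℝ} (hM : ∀ x, ‖Torus.fderiv f x‖ ≤ M)
    (hres : |∫ x, ⟪Torus.convect u u x - f x, f x⟫_ℝ| ≤ R * Real.sqrt (Torus.gradNormSq f)) :
    ∫ x, ‖f x‖ ^ 2 ≤ R * Real.sqrt (Torus.gradNormSq f) + M * ∫ x, ‖u x‖ ^ 2 := by
  have i1 : Integrable (fun x => ⟪Torus.convect u u x, f x⟫_ℝ) volume := ((hu.convect hu).inner hf).integrable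
  have i2 : Integrable (fun x => ⟪f x, f x⟫_ℝ) volume := (hf.inner hf).integrable
  have hsplit : ∫ x, ⟪Torus.convect u u x - f x, f x⟫_ℝ =
      (∫ x, ⟪Torus.convect u u x, f x⟫_ℝ) - ∫ x, ‖f x‖ ^ 2 := by
    have hff : ∫ x, ⟪f x, f x⟫_ℝ = ∫ x, ‖f x‖ ^ 2 :=
      integral_congr_ae (ae_of_all _ fun x => real_inner_self_eq_norm_sq _)
    rw [← hff, ← integral_sub i1 i2]
    exact integral_congr_ae (ae_of_all _ fun x => inner_sub_left _ _ _)
  -- antisymmetry of the trilinear form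
  have hanti : ∫ x, ⟪Torus.convect u u x, f x⟫_ℝ = -∫ x, ⟪u x, Torus.convect u f x⟫_ℝ :=
    Torus.integral_inner_convect_eq_neg hu hud hu hf
  -- `|∫⟪u, (u·∇)f⟫| ≤ M ∫‖u‖²`
  have hconv : |∫ x, ⟪u x, Torus.convect u f x⟫_ℝ| ≤ M * ∫ x, ‖u x‖ ^ 2 := by
    rw [← integral_const_mul]
    refine (abs_integral_le_integral_abs).trans (integral_mono (hu.inner (hu.convect hf)).integrable.abs
      (hu.norm_sq.integrable.const_mul M) fun x => ?_)
    have hle : |⟪u x, Torus.convect u f x⟫_ℝ| ≤ ‖u x‖ * ‖Torus.convect u f x‖ := abs_real_inner_le_norm _ _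
    have hcv : ‖Torus.convect u f x‖ ≤ M * ‖u x‖ :=
      ((Torus.fderiv f x).le_opNorm (u x)).trans (mul_le_mul_of_nonneg_right (hM x) (norm_nonneg _))
    calc |⟪u x, Torus.convect u f x⟫_ℝ| ≤ ‖u x‖ * ‖Torus.convect u f x‖ := hle
      _ ≤ ‖u x‖ * (M * ‖u x‖) := mul_le_mul_of_nonneg_left hcv (norm_nonneg _)
      _ = M * ‖u x‖ ^ 2 := by ring
  have h1 : (∫ x, ‖f x‖ ^ 2) - R * Real.sqrt (Torus.gradNormSq f) ≤ ∫ x, ⟪Torus.convect u u x, f x⟫_ℝ := by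
    have := (abs_le.1 hres).1
    rw [hsplit] at this
    linarith
  rw [hanti] at h1
  have h2 : -∫ x, ⟪u x, Torus.convect u f x⟫_ℝ ≤ M * ∫ x, ‖u x‖ ^ 2 := (neg_le_abs _).trans hconv
  linarith

/-- **No bad sequence in the small-energy regime.** If `‖Df‖ ≤ M` and `M · E < ∫‖f‖²`, then every sequence
satisfying the hypotheses of `NoOnsagerDodger f E` is absent, so its conclusion holds (vacuously): the
residual bounds tested on `w = f` give `∫‖f‖² ≤ R_n √(gradNormSq f) + M E` for all `n`, impossible once
`R_n` is small. Stated in the exact shape of the registered stub, for a general smooth admissible `f`. -/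
theorem noOnsagerDodger_of_smallEnergy {f : (UnitAddTorus (Fin 3) → EuclideanSpace ℝ (Fin 3))} (hf : Torus.IsSmooth f) (hfd : Torus.IsDivFree f)
    (hf0 : Torus.HasZeroMean f) {M E : ℝ} (hM : ∀ x, ‖Torus.fderiv f x‖ ≤ M) (hME : M * E < ∫ x, ‖f x‖ ^ 2)
    (u : ℕ → (UnitAddTorus (Fin 3) → EuclideanSpace ℝ (Fin 3))) (R : ℕ → ℝ)
    (hseq : ∀ n : ℕ, Torus.IsSmooth (u n) ∧ Torus.IsDivFree (u n) ∧ Torus.HasZeroMean (u n) ∧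
      ∫ x, ‖u n x‖ ^ 2 ≤ E ∧ 0 ≤ R n ∧
      ∀ w : (UnitAddTorus (Fin 3) → EuclideanSpace ℝ (Fin 3)), Torus.IsSmooth w → Torus.IsDivFree w → Torus.HasZeroMean w →
        |∫ x, ⟪Torus.convect (u n) (u n) x - f x, w x⟫_ℝ| ≤ R n * Real.sqrt (Torus.gradNormSq w))
    (hR : Tendsto R atTop (𝓝 0)) :
    ∃ B : ℝ, ∀ N : ℕ, ∃ n : ℕ, N ≤ n ∧ Torus.gradNormSq (u n) ≤ B := by
  exfalso
  have hM0 : 0 ≤ M := (norm_nonneg _).trans (hM 0)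
  -- every member of the sequence obeys `∫‖f‖² ≤ R_n √G_f + M E`
  have hn : ∀ n, ∫ x, ‖f x‖ ^ 2 ≤ R n * Real.sqrt (Torus.gradNormSq f) + M * E := by
    intro n
    obtain ⟨hus, hud, -, hE, -, hres⟩ := hseq n
    have h := integral_norm_sq_le_of_residualBound hf hus hud hM (hres f hf hfd hf0)
    have hmono : M * ∫ x, ‖u n x‖ ^ 2 ≤ M * E := mul_le_mul_of_nonneg_left hE hM0
    linarith
  -- but `R_n √G_f → 0`
  have hlim : Tendsto (fun n => R n * Real.sqrt (Torus.gradNormSq f) + M * E) atTop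
      (𝓝 (0 * Real.sqrt (Torus.gradNormSq f) + M * E)) :=
    (hR.mul_const _).add_const _
  rw [zero_mul, zero_add] at hlim
  have hle : ∫ x, ‖f x‖ ^ 2 ≤ M * E := ge_of_tendsto hlim (Eventually.of_forall hn)
  linarith

/-! ## The instance for the line's witness `f₁₂₃` -/

/-- The three frequencies of `f₁₂₃` are nonzero. -/
theorem f123_freq_ne_zero' : ∀ m, (![![0, 0, 1], ![2, 0, 0], ![0, 3, 0]] : Fin 3 → (Fin 3 → ℤ)) m ≠ 0 := by decide

/-- The frequencies of `f₁₂₃` are in normal form (pairwise distinct and non-opposite). -/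
theorem f123_normalForm' : ∀ m m' : Fin 3, m ≠ m' → (![![0, 0, 1], ![2, 0, 0], ![0, 3, 0]] : Fin 3 → (Fin 3 → ℤ)) m ≠ (![![0, 0, 1], ![2, 0, 0], ![0, 3, 0]] : Fin 3 → (Fin 3 → ℤ)) m' ∧ (![![0, 0, 1], ![2, 0, 0], ![0, 3, 0]] : Fin 3 → (Fin 3 → ℤ)) m ≠ -(![![0, 0, 1], ![2, 0, 0], ![0, 3, 0]] : Fin 3 → (Fin 3 → ℤ)) m' := by decide

/-- The amplitudes of `f₁₂₃` are transversal (`kₘ · zₘ = 0`). -/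
theorem f123_transversal' : ∀ m, ((fun j => (((![![0, 0, 1], ![2, 0, 0], ![0, 3, 0]] : Fin 3 → (Fin 3 → ℤ)) m) j : ℂ)) ⬝ᵥ (WithLp.ofLp ((![(WithLp.toLp 2 ![-Complex.I, 0, 0] : EuclideanSpace ℂ (Fin 3)), (WithLp.toLp 2 ![0, -Complex.I, 0] : EuclideanSpace ℂ (Fin 3)), (WithLp.toLp 2 ![0, 0, -Complex.I] : EuclideanSpace ℂ (Fin 3))] : Fin 3 → EuclideanSpace ℂ (Fin 3)) m))) = 0 := by
  intro m
  fin_cases m <;>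
    simp [dotProduct, Fin.sum_univ_three, Matrix.cons_val_zero, Matrix.cons_val_one, Matrix.cons_val_two,
      Matrix.head_cons, Matrix.tail_cons]

/-- Energy of the witness: `∫ ‖f₁₂₃‖² = 3/2`. -/
theorem f123_integral_norm_sq' : ∫ x, ‖(∑ mm, Torus.realTrigPoly {(![![0, 0, 1], ![2, 0, 0], ![0, 3, 0]] : Fin 3 → (Fin 3 → ℤ)) mm} (fun _ => (![(WithLp.toLp 2 ![-Complex.I, 0, 0] : EuclideanSpace ℂ (Fin 3)), (WithLp.toLp 2 ![0, -Complex.I, 0] : EuclideanSpace ℂ (Fin 3)), (WithLp.toLp 2 ![0, 0, -Complex.I] : EuclideanSpace ℂ (Fin 3))] : Fin 3 → EuclideanSpace ℂ (Fin 3)) mm)) x‖ ^ 2 = 3 / 2 := by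
  rw [integral_norm_sq_modes_of_normalForm f123_freq_ne_zero' f123_normalForm']
  simp only [Fin.sum_univ_three, Matrix.cons_val_zero, Matrix.cons_val_one, Matrix.cons_val_two,
    Matrix.head_cons, Matrix.tail_cons, EuclideanSpace.norm_eq]
  simp [Complex.norm_I]
  norm_num

/-- **`stub_f123NoOnsagerDodger` holds below a positive energy threshold** (the vacuous regime of the
floor stub of line `lamb-floor-f123-shared-ceiling`): there is `E₀ > 0` (namely `(3/2)/M` for any derivative
bound `‖Df₁₂₃‖ ≤ M`) such that for every `E < E₀` the registered stub's conclusion holds for every sequence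
satisfying its hypotheses — indeed no such sequence exists. The third hypothesis of the stub (vanishing
virtual dissipation) is not even needed here. -/
theorem stub_f123NoOnsagerDodgerSmallEnergy :
    ∃ E₀ : ℝ, 0 < E₀ ∧ ∀ E : ℝ, E < E₀ →
      ∀ (u : ℕ → UnitAddTorus (Fin 3) → EuclideanSpace ℝ (Fin 3)) (R : ℕ → ℝ),
        (∀ n : ℕ, Torus.IsSmooth (u n) ∧ Torus.IsDivFree (u n) ∧ Torus.HasZeroMean (u n) ∧
          ∫ x, ‖u n x‖ ^ 2 ≤ E ∧ 0 ≤ R n ∧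
          ∀ w : UnitAddTorus (Fin 3) → EuclideanSpace ℝ (Fin 3),
            Torus.IsSmooth w → Torus.IsDivFree w → Torus.HasZeroMean w →
            |∫ x, inner ℝ (Torus.convect (u n) (u n) x - (∑ mm, Torus.realTrigPoly {(![![0, 0, 1], ![2, 0, 0], ![0, 3, 0]] : Fin 3 → (Fin 3 → ℤ)) mm} (fun _ => (![(WithLp.toLp 2 ![-Complex.I, 0, 0] : EuclideanSpace ℂ (Fin 3)), (WithLp.toLp 2 ![0, -Complex.I, 0] : EuclideanSpace ℂ (Fin 3)), (WithLp.toLp 2 ![0, 0, -Complex.I] : EuclideanSpace ℂ (Fin 3))] : Fin 3 → EuclideanSpace ℂ (Fin 3)) mm)) x) (w x)| ≤ R n * Real.sqrt (Torus.gradNormSq w)) →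
        Filter.Tendsto R Filter.atTop (nhds 0) →
        Filter.Tendsto (fun n => R n * Real.sqrt (Torus.gradNormSq (u n))) Filter.atTop (nhds 0) →
        ∃ B : ℝ, ∀ N : ℕ, ∃ n : ℕ, N ≤ n ∧ Torus.gradNormSq (u n) ≤ B := by
  have hfs : Torus.IsSmooth (∑ mm, Torus.realTrigPoly {(![![0, 0, 1], ![2, 0, 0], ![0, 3, 0]] : Fin 3 → (Fin 3 → ℤ)) mm} (fun _ => (![(WithLp.toLp 2 ![-Complex.I, 0, 0] : EuclideanSpace ℂ (Fin 3)), (WithLp.toLp 2 ![0, -Complex.I, 0] : EuclideanSpace ℂ (Fin 3)), (WithLp.toLp 2 ![0, 0, -Complex.I] : EuclideanSpace ℂ (Fin 3))] : Fin 3 → EuclideanSpace ℂ (Fin 3)) mm)) := isSmooth_modes _ _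
  have hfd : Torus.IsDivFree (∑ mm, Torus.realTrigPoly {(![![0, 0, 1], ![2, 0, 0], ![0, 3, 0]] : Fin 3 → (Fin 3 → ℤ)) mm} (fun _ => (![(WithLp.toLp 2 ![-Complex.I, 0, 0] : EuclideanSpace ℂ (Fin 3)), (WithLp.toLp 2 ![0, -Complex.I, 0] : EuclideanSpace ℂ (Fin 3)), (WithLp.toLp 2 ![0, 0, -Complex.I] : EuclideanSpace ℂ (Fin 3))] : Fin 3 → EuclideanSpace ℂ (Fin 3)) mm)) := isDivFree_modes _ _ f123_transversal'
  have hf0 : Torus.HasZeroMean (∑ mm, Torus.realTrigPoly {(![![0, 0, 1], ![2, 0, 0], ![0, 3, 0]] : Fin 3 → (Fin 3 → ℤ)) mm} (fun _ => (![(WithLp.toLp 2 ![-Complex.I, 0, 0] : EuclideanSpace ℂ (Fin 3)), (WithLp.toLp 2 ![0, -Complex.I, 0] : EuclideanSpace ℂ (Fin 3)), (WithLp.toLp 2 ![0, 0, -Complex.I] : EuclideanSpace ℂ (Fin 3))] : Fin 3 → EuclideanSpace ℂ (Fin 3)) mm)) := hasZeroMean_modes _ _ f123_freq_ne_zero'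
  obtain ⟨M, hM0, hM⟩ := exists_bound_fderiv' hfs
  refine ⟨(3 / 2) / (M + 1), div_pos (by norm_num) (by linarith), fun E hE u R hseq hR _ => ?_⟩
  refine noOnsagerDodger_of_smallEnergy hfs hfd hf0 (M := M + 1) (fun x => (hM x).trans (by linarith)) ?_ u R hseq hR
  rw [f123_integral_norm_sq']
  have hM1 : 0 < M + 1 := by linarith
  calc (M + 1) * E < (M + 1) * ((3 / 2) / (M + 1)) := mul_lt_mul_of_pos_left hE hM1
    _ = 3 / 2 := mul_div_cancel₀ _ hM1.ne'

end Summit.AnomalousDissipation.AnomalousDissipation.Theorems.SteadyStatesLoudBounded.F123SmallEnergy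

end
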